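import Literature.Computability.AlgebraicComplexity.PrattPackingTransfer
import Literature.Computability.AlgebraicComplexity.PrattTrapezoidValSTPP
import Literature.Computability.AlgebraicComplexity.GroupTheoreticMatMulThmBProofs
import Literature.Combinatorics.Additive.TightTriangleRemovalProofs
import Literature.Combinatorics.Additive.TightTriangleRemovalSumMin
import Literature.Combinatorics.Additive.TightTriangleRemovalThm1Proofs
import HarnessLib

/-!
# Pratt 2024, Cor. 2.10: the named fact `pratt2024_cor210` is FALSE; what is true instead

Topic `Literature/Computability/AlgebraicComplexity` (family `MatrixMultiplication`). Companion
("Proofs") file of `PrattPackingTransfer.lean`, which vendors K. Pratt, *On generalized corners and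
matrix multiplication*, ITCS 2024 (arXiv:2309.03878), Cor. 2.10 (held text, p. 6: "There exists an
absolute constant `C > 1` such that if `Xᵢ, Yᵢ, Zᵢ` satisfy the STPP in `ℤ_q^ℓ`, then at least one of
`Σ|Xᵢ||Yᵢ|, Σ|Xᵢ||Zᵢ|, Σ|Yᵢ||Zᵢ|` is at most `(q/C)^ℓ`.") as the named fact `pratt2024_cor210`
(families indexed by a `Fintype`, the tree's `AddSimultaneousTPP`, all parts nonempty).

## Main results (all PROVED; no new named fact)

* `not_pratt2024_cor210 : ¬ pratt2024_cor210` — **the printed corollary is false**, also in this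
  rendering. The counterexample is the tree's three-block family
  (`Literature.Combinatorics.Additive.threeBlockA/B/C`, `isSTPP_threeBlock`,
  `TightTriangleRemovalProofs.lean`, where the sibling rendering
  `Literature.Combinatorics.Additive.Pratt2024_cor210` is refuted by `not_Pratt2024_cor210`): in
  `𝔽₂³ × 𝔽₂³ × 𝔽₂ⁿ ≅ 𝔽₂^{n+6}` the blocks `(e₀ ⊕ 0 ⊕ 𝔽₂ⁿ, {0}, {0 ⊕ e₀ ⊕ 0})`,
  `({e₁ ⊕ 0 ⊕ 0}, 0 ⊕ 0 ⊕ 𝔽₂ⁿ, {0 ⊕ e₁ ⊕ 0})`, `({e₂ ⊕ 0 ⊕ 0}, {0}, 0 ⊕ e₂ ⊕ 𝔽₂ⁿ)` form an STPP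
  family ALL OF WHOSE NINE SETS ARE NONEMPTY, and each of the three packing sums is `≥ 2ⁿ`, which
  exceeds `(2/C)^{n+6}` as soon as `Cⁿ > 64`. So the nonemptiness proviso of `pratt2024_cor210`
  (which only removes junk families with empty parts) does not rescue the printed statement. The
  gap in print is the pigeonhole step of the proof of Cor. 2.9 ("Hence by the pigeonhole principle
  there is some `i` for which …", p. 6), which mixes three differently weighted averages over the
  block index; it is valid for UNIFORM families only.
* `pratt2024_cor210_sumMin` — **what the printed argument proves, for primes** (the corrected
  statement, in the vocabulary of `pratt2024_cor210` and with the printed shape of the bound,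
  no extra constant): there is an absolute `C > 1` such that for every prime `p`, every `ℓ` and
  every STPP family `(Xᵢ, Yᵢ, Zᵢ)_{i ∈ ι}` in `𝔽_p^ℓ`,
  `Σᵢ min(|Xᵢ||Yᵢ|, |Xᵢ||Zᵢ|, |Yᵢ||Zᵢ|) ≤ (p/C)^ℓ`.
  Proof: the tree's `sum_min_packing_le_of_foxLovasz` (`TightTriangleRemovalSumMin.lean`: Pratt's
  argument with the pigeonhole step repaired, giving `≤ K (p/γ)^ℓ`) fed with the tree's discharge
  `FoxLovasz2017_thm1_holds` of Fox–Lovász 2017, Thm. 1 (`TightTriangleRemovalThm1Proofs.lean`),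
  and the constant `K` removed by the tensor-power trick: the `k`-th power of an STPP family
  (`AddSimultaneousTPP.pi`, boxes in `(𝔽_p^ℓ)^k ≅ 𝔽_p^{kℓ}`) is an STPP family whose sum of
  blockwise minima is at least the `k`-th power of the original one (`pow_sum_min_le`), so
  `S^k ≤ K ((p/γ)^ℓ)^k` for all `k`, whence `S ≤ (p/γ)^ℓ`.
* `pratt2024_cor210_uniform` — **Cor. 2.10 as printed holds for uniform families in `𝔽_p^ℓ`**
  (`|Xᵢ|, |Yᵢ|, |Zᵢ|` independent of `i`, the case that matters for bounds on `ω`): one of the three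
  full packing sums is `≤ (p/C)^ℓ`.

Prime powers `q` (the printed generality, used in Pratt's Thm. 4.4) would follow verbatim from a
prime-power version of Fox–Lovász's removal lemma, asserted in Pratt's footnote 1 ("it extends to
`ℤ_q^ℓ` by the same argument via the use of [BCCGNSU 2017]") but not in print; it is not in the
tree and nothing is claimed about it here.
-- TODO(general form): `q` a prime power, once tight removal in `(ℤ/q)^ℓ` is in the tree.

## References

* [Pratt2024] K. Pratt, *On generalized corners and matrix multiplication*, ITCS 2024, LIPIcs 287,
  89:1–17; arXiv:2309.03878 — Cor. 2.9 and its proof, Cor. 2.10 and footnote 1 (p. 6).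
* [FoxLovasz2017] J. Fox, L. M. Lovász, *A tight bound for Green's arithmetic triangle removal
  lemma in vector spaces*, SODA 2017 — Thm. 1.
* [CohnKleinbergSzegedyUmans2005] H. Cohn, R. Kleinberg, B. Szegedy, C. Umans, *Group-theoretic
  algorithms for matrix multiplication*, FOCS 2005 — Def. 5.1 (STPP), Lemma 5.4 (products).
-/

noncomputable section

open Finset
open scoped BigOperators

namespace Literature.Computability.AlgebraicComplexity

open Literature.Combinatorics.Additive

/-! ### The refutation -/

/-- **Pratt 2024, Cor. 2.10 is false as printed** — refutation of the named fact
`pratt2024_cor210`: for every `C > 1` the three-block STPP family of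
`TightTriangleRemovalProofs.lean` in `(ℤ/2)^{n+6}` (`Cⁿ > 64`; all nine sets nonempty) has all
three packing sums `Σ|Xᵢ||Yᵢ|`, `Σ|Xᵢ||Zᵢ|`, `Σ|Yᵢ||Zᵢ|` at least `2ⁿ > (2/C)^{n+6}`.
[cite: Pratt2024, Cor. 2.10] -/
theorem not_pratt2024_cor210 : ¬ pratt2024_cor210 := by
  rintro ⟨C, hC, h⟩
  obtain ⟨n, hn⟩ := pow_unbounded_of_one_lt (64 * (1 : ℝ)) hC
  -- coordinatise `𝔽₂³ × 𝔽₂³ × 𝔽₂ⁿ` as `𝔽₂^{n+6}`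
  have hrank : Module.finrank (ZMod 2) ((Fin 3 → ZMod 2) × (Fin 3 → ZMod 2) × (Fin n → ZMod 2)) =
      Module.finrank (ZMod 2) (Fin (n + 6) → ZMod 2) := by
    simp only [Module.finrank_prod, Module.finrank_fin_fun]
    omega
  set e := LinearEquiv.ofFinrankEq _ _ hrank with he_def
  have he : Function.Injective e := e.injective
  have hS := (isSTPP_iff_addSimultaneousTPP _ _ _).1
    ((isSTPP_threeBlock (Fin n → ZMod 2)).image e he)
  have hne : ∀ i : Fin 3,
      ((threeBlockA (Fin n → ZMod 2) i).image e).Nonempty ∧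
        ((threeBlockB (Fin n → ZMod 2) i).image e).Nonempty ∧
          ((threeBlockC (Fin n → ZMod 2) i).image e).Nonempty := by
    intro i
    refine ⟨Finset.Nonempty.image ?_ _, Finset.Nonempty.image ?_ _, Finset.Nonempty.image ?_ _⟩
    · fin_cases i <;> simp [threeBlockA, bigA]
    · fin_cases i <;> simp [threeBlockB, bigB]
    · fin_cases i <;> simp [threeBlockC, bigC]
  have hmain := h 2 (n + 6) Nat.prime_two.isPrimePow (Fin 3) _ _ _ hS hne
  simp only [Finset.card_image_of_injective _ he] at hmain
  have hV : Fintype.card (Fin n → ZMod 2) = 2 ^ n := by simp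
  have hlt : ((2 : ℝ) / C) ^ (n + 6) < (2 : ℝ) ^ n := by
    simpa only [one_mul] using mul_div_pow_lt_two_pow hC hn
  have cast2 : ((2 ^ n : ℕ) : ℝ) = (2 : ℝ) ^ n := by push_cast; ring
  have hAB : (2 : ℝ) ^ n ≤ ∑ i, (((threeBlockA (Fin n → ZMod 2) i).card *
      (threeBlockB (Fin n → ZMod 2) i).card : ℕ) : ℝ) := by
    rw [← Nat.cast_sum, ← cast2, ← hV]
    exact_mod_cast card_le_sum_threeBlockAB (Fin n → ZMod 2)
  have hAC : (2 : ℝ) ^ n ≤ ∑ i, (((threeBlockA (Fin n → ZMod 2) i).card *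
      (threeBlockC (Fin n → ZMod 2) i).card : ℕ) : ℝ) := by
    rw [← Nat.cast_sum, ← cast2, ← hV]
    have h' := card_le_sum_threeBlockCA (Fin n → ZMod 2)
    simp_rw [mul_comm ((threeBlockC (Fin n → ZMod 2) _).card)] at h'
    exact_mod_cast h'
  have hBC : (2 : ℝ) ^ n ≤ ∑ i, (((threeBlockB (Fin n → ZMod 2) i).card *
      (threeBlockC (Fin n → ZMod 2) i).card : ℕ) : ℝ) := by
    rw [← Nat.cast_sum, ← cast2, ← hV]
    exact_mod_cast card_le_sum_threeBlockBC (Fin n → ZMod 2)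
  have hq : ((2 : ℕ) : ℝ) = (2 : ℝ) := by norm_num
  rw [hq] at hmain
  rcases hmain with h1 | h2 | h3
  · exact absurd (hAB.trans h1) (not_le.2 hlt)
  · exact absurd (hAC.trans h2) (not_le.2 hlt)
  · exact absurd (hBC.trans h3) (not_le.2 hlt)

/-! ### The corrected statement: the sum of blockwise minima (primes) -/

/-- "Take `k`-th roots and let `k → ∞`": if `a^k ≤ K b^k` for all `k` (`b > 0`) then `a ≤ b`.
[folklore] -/
theorem le_of_forall_pow_le_const_mul_pow {a b K : ℝ} (hb : 0 < b)
    (h : ∀ k : ℕ, a ^ k ≤ K * b ^ k) : a ≤ b := by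
  by_contra hab
  rw [not_le] at hab
  have h1 : 1 < a / b := (one_lt_div hb).2 hab
  obtain ⟨k, hk⟩ := pow_unbounded_of_one_lt K h1
  have h2 := h k
  rw [div_pow, lt_div_iff₀ (pow_pos hb k)] at hk
  linarith

/-- **Reindexing**: a bound valid for all `Fin N`-indexed STPP families (the route predicate
`IsSTPP`) is valid for all STPP families indexed by a `Fintype` (the tree's `AddSimultaneousTPP`),
the sum of blockwise minima being invariant under reindexing. [folklore] -/
theorem sum_min_le_of_forall_isSTPP {H : Type*} [AddCommGroup H] {M : ℝ}
    (hM : ∀ (N : ℕ) (A B C : Fin N → Finset H), IsSTPP A B C →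
      (∑ j, ((min ((A j).card * (B j).card)
          (min ((B j).card * (C j).card) ((C j).card * (A j).card)) : ℕ) : ℝ)) ≤ M)
    {ι : Type*} [Fintype ι] {A B C : ι → Finset H} (hS : AddSimultaneousTPP A B C) :
    (∑ i, ((min ((A i).card * (B i).card)
        (min ((B i).card * (C i).card) ((C i).card * (A i).card)) : ℕ) : ℝ)) ≤ M := by
  classical
  set σ := (Fintype.equivFin ι).symm with hσ_def
  have h := hM _ (A ∘ σ) (B ∘ σ) (C ∘ σ)
    ((isSTPP_iff_addSimultaneousTPP _ _ _).2 (hS.comp σ.injective))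
  calc (∑ i, ((min ((A i).card * (B i).card)
          (min ((B i).card * (C i).card) ((C i).card * (A i).card)) : ℕ) : ℝ))
      = ∑ j, ((min ((A (σ j)).card * (B (σ j)).card)
          (min ((B (σ j)).card * (C (σ j)).card) ((C (σ j)).card * (A (σ j)).card)) : ℕ) : ℝ) :=
        (Equiv.sum_comp σ (fun i => ((min ((A i).card * (B i).card)
          (min ((B i).card * (C i).card) ((C i).card * (A i).card)) : ℕ) : ℝ))).symm
    _ ≤ M := h

/-- **Supermultiplicativity of the sum of blockwise minima**: for the `k`-th power of a family
with block sizes `(xᵢ, yᵢ, zᵢ)` (blocks indexed by words `I : Fin k → ι`, sizes the products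
along the word), the sum of blockwise minima is at least the `k`-th power of the original one,
since `min(∏xy, ∏yz, ∏zx) ≥ ∏ min(xy, yz, zx)` termwise. [folklore] -/
theorem pow_sum_min_le {ι : Type*} [Fintype ι] (x y z : ι → ℕ) (k : ℕ) :
    (∑ i, min (x i * y i) (min (y i * z i) (z i * x i))) ^ k ≤
      ∑ I : Fin k → ι, min ((∏ l, x (I l)) * ∏ l, y (I l))
        (min ((∏ l, y (I l)) * ∏ l, z (I l)) ((∏ l, z (I l)) * ∏ l, x (I l))) := by
  classical
  rw [Finset.sum_pow', Fintype.piFinset_univ]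
  refine Finset.sum_le_sum fun I _ => le_min ?_ (le_min ?_ ?_)
  · rw [← Finset.prod_mul_distrib]
    exact Finset.prod_le_prod (fun _ _ => Nat.zero_le _) fun l _ => min_le_left _ _
  · rw [← Finset.prod_mul_distrib]
    exact Finset.prod_le_prod (fun _ _ => Nat.zero_le _) fun l _ =>
      (min_le_right _ _).trans (min_le_left _ _)
  · rw [← Finset.prod_mul_distrib]
    exact Finset.prod_le_prod (fun _ _ => Nat.zero_le _) fun l _ =>
      (min_le_right _ _).trans (min_le_right _ _)

/-- **Powers of an STPP family in `𝔽_p^ℓ`, coordinatised** (CKSU 2005, Lemma 5.4: products of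
STPP families are STPP families; the tree's `AddSimultaneousTPP.pi`): the `k`-th power of an STPP
family `(Xᵢ, Yᵢ, Zᵢ)_{i ∈ ι}` in `𝔽_p^ℓ`, transported along a linear isomorphism
`(𝔽_p^ℓ)^k ≅ 𝔽_p^{kℓ}`, is an STPP family in `𝔽_p^{kℓ}` indexed by words `I : Fin k → ι` with
block sizes `(∏_l |X_{I l}|, ∏_l |Y_{I l}|, ∏_l |Z_{I l}|)`.
[cite: CohnKleinbergSzegedyUmans2005, Lemma 5.4] -/
theorem exists_addSimultaneousTPP_pow {p ℓ : ℕ} [Fact p.Prime] {ι : Type} [Fintype ι]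
    {X Y Z : ι → Finset (Fin ℓ → ZMod p)} (hS : AddSimultaneousTPP X Y Z) (k : ℕ) :
    ∃ A B C : (Fin k → ι) → Finset (Fin (k * ℓ) → ZMod p), AddSimultaneousTPP A B C ∧
      (∀ I, (A I).card = ∏ l, (X (I l)).card) ∧ (∀ I, (B I).card = ∏ l, (Y (I l)).card) ∧
        ∀ I, (C I).card = ∏ l, (Z (I l)).card := by
  classical
  have hrank : Module.finrank (ZMod p) (Fin k → Fin ℓ → ZMod p) =
      Module.finrank (ZMod p) (Fin (k * ℓ) → ZMod p) := by
    rw [Module.finrank_pi_fintype, Module.finrank_fin_fun, Finset.sum_const, Finset.card_univ,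
      Fintype.card_fin, Module.finrank_fin_fun, smul_eq_mul]
  set e := LinearEquiv.ofFinrankEq _ _ hrank with he_def
  have he : Function.Injective e := e.injective
  have hSk : AddSimultaneousTPP (G := Fin k → Fin ℓ → ZMod p)
      (fun I : Fin k → ι => Fintype.piFinset fun l => X (I l))
      (fun I => Fintype.piFinset fun l => Y (I l))
      (fun I => Fintype.piFinset fun l => Z (I l)) := hS.pi
  have hSe := addSimultaneousTPP_image_of_reflect hSk e fun a b c a' b' c' h =>
    he (by simpa only [map_add] using h)
  refine ⟨_, _, _, hSe, fun I => ?_, fun I => ?_, fun I => ?_⟩ <;>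
    simp only [Finset.card_image_of_injective _ he, Fintype.card_piFinset]

/-- **Pratt 2024, Cor. 2.10 — corrected statement (sum of blockwise minima), for primes, with
the printed shape of the bound.** There is an absolute constant `C > 1` such that for every prime
`p`, every `ℓ` and every STPP family `(Xᵢ, Yᵢ, Zᵢ)_{i ∈ ι}` of finite subsets of `𝔽_p^ℓ` (the tree's
`AddSimultaneousTPP`, CKSU Def. 5.1), `Σᵢ min(|Xᵢ||Yᵢ|, |Xᵢ||Zᵢ|, |Yᵢ||Zᵢ|) ≤ (p/C)^ℓ`. This is what
the printed proof of Cor. 2.9/2.10 establishes (a removal set for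
`(⊔(Xᵢ−Yᵢ), ⊔(Yᵢ−Zᵢ), ⊔(Zᵢ−Xᵢ))` meets a fixed fraction of ONE of the three difference sets of
EVERY block; tight removal, Fox–Lovász Thm. 1), whereas the printed conclusion — one of the three
FULL packing sums is small — is false (`not_pratt2024_cor210`). Proof: the tree's
`sum_min_packing_le_of_foxLovasz` (bound `K (p/γ)^ℓ`, conditional on `FoxLovasz2017_thm1`) and
`FoxLovasz2017_thm1_holds`, with `K` removed by the tensor-power trick
(`exists_addSimultaneousTPP_pow`, `pow_sum_min_le`). Primes only: the prime-power case of print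
rests on a prime-power removal lemma that is not in print (Pratt, footnote 1).
[cite: Pratt2024, Cor. 2.10] [cite: FoxLovasz2017, Thm. 1] -/
theorem pratt2024_cor210_sumMin :
    ∃ C : ℝ, 1 < C ∧ ∀ (p ℓ : ℕ), p.Prime → ∀ (ι : Type) [Fintype ι]
      (X Y Z : ι → Finset (Fin ℓ → ZMod p)), AddSimultaneousTPP X Y Z →
        (∑ i, ((min ((X i).card * (Y i).card)
            (min ((X i).card * (Z i).card) ((Y i).card * (Z i).card)) : ℕ) : ℝ)) ≤
          ((p : ℝ) / C) ^ ℓ := by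
  obtain ⟨γ, hγ, K, hK⟩ := sum_min_packing_le_of_foxLovasz FoxLovasz2017_thm1_holds
  refine ⟨γ, hγ, fun p ℓ hp ι _ X Y Z hS => ?_⟩
  classical
  haveI : Fact p.Prime := ⟨hp⟩
  have hp0 : (0 : ℝ) < p := by exact_mod_cast hp.pos
  have hγ0 : 0 < γ := zero_lt_one.trans hγ
  have hb : 0 < ((p : ℝ) / γ) ^ ℓ := by positivity
  -- the statement's minima, in the cyclic order used by the tree
  have hmin : ∀ i, min ((X i).card * (Y i).card)
      (min ((X i).card * (Z i).card) ((Y i).card * (Z i).card)) =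
        min ((X i).card * (Y i).card) (min ((Y i).card * (Z i).card) ((Z i).card * (X i).card)) := by
    intro i
    rw [min_comm ((X i).card * (Z i).card), mul_comm ((X i).card) ((Z i).card)]
  simp_rw [hmin]
  rw [← Nat.cast_sum]
  refine le_of_forall_pow_le_const_mul_pow (K := K) hb fun k => ?_
  obtain ⟨A, B, C, hABC, hA, hB, hC⟩ := exists_addSimultaneousTPP_pow hS k
  have h1 := pow_sum_min_le (fun i => (X i).card) (fun i => (Y i).card) (fun i => (Z i).card) k
  have h2 := sum_min_le_of_forall_isSTPP (hK p (k * ℓ) hp) hABC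
  simp only [hA, hB, hC] at h2
  calc (((∑ i, min ((X i).card * (Y i).card)
          (min ((Y i).card * (Z i).card) ((Z i).card * (X i).card)) : ℕ) : ℝ)) ^ k
      = (((∑ i, min ((X i).card * (Y i).card)
          (min ((Y i).card * (Z i).card) ((Z i).card * (X i).card))) ^ k : ℕ) : ℝ) := by
        push_cast; rfl
    _ ≤ ((∑ I : Fin k → ι, min ((∏ l, (X (I l)).card) * ∏ l, (Y (I l)).card)
          (min ((∏ l, (Y (I l)).card) * ∏ l, (Z (I l)).card)
            ((∏ l, (Z (I l)).card) * ∏ l, (X (I l)).card)) : ℕ) : ℝ) := by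
        exact_mod_cast h1
    _ = ∑ I : Fin k → ι, ((min ((∏ l, (X (I l)).card) * ∏ l, (Y (I l)).card)
          (min ((∏ l, (Y (I l)).card) * ∏ l, (Z (I l)).card)
            ((∏ l, (Z (I l)).card) * ∏ l, (X (I l)).card)) : ℕ) : ℝ) := by
        push_cast; rfl
    _ ≤ K * ((p : ℝ) / γ) ^ (k * ℓ) := h2
    _ = K * (((p : ℝ) / γ) ^ ℓ) ^ k := by rw [mul_comm k ℓ, pow_mul]

/-- **Pratt 2024, Cor. 2.10 AS PRINTED holds for uniform families in `𝔽_p^ℓ`**: with the absolute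
`C > 1` of `pratt2024_cor210_sumMin`, for every prime `p`, every `ℓ` and every STPP family in
`𝔽_p^ℓ` all of whose blocks have the same shape (`|Xᵢ| = a`, `|Yᵢ| = b`, `|Zᵢ| = c` — the case
relevant to bounds on `ω`), one of `Σ|Xᵢ||Yᵢ|`, `Σ|Xᵢ||Zᵢ|`, `Σ|Yᵢ||Zᵢ|` is at most `(p/C)^ℓ` (for such
families the sum of blockwise minima is the minimum of the three packing sums). The uniformity
hypothesis cannot be dropped (`not_pratt2024_cor210`). [cite: Pratt2024, Cor. 2.10] -/
theorem pratt2024_cor210_uniform :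
    ∃ C : ℝ, 1 < C ∧ ∀ (p ℓ : ℕ), p.Prime → ∀ (ι : Type) [Fintype ι]
      (X Y Z : ι → Finset (Fin ℓ → ZMod p)), AddSimultaneousTPP X Y Z →
        (∃ a b c : ℕ, ∀ i, (X i).card = a ∧ (Y i).card = b ∧ (Z i).card = c) →
          (∑ i, (((X i).card * (Y i).card : ℕ) : ℝ)) ≤ ((p : ℝ) / C) ^ ℓ ∨
          (∑ i, (((X i).card * (Z i).card : ℕ) : ℝ)) ≤ ((p : ℝ) / C) ^ ℓ ∨
          (∑ i, (((Y i).card * (Z i).card : ℕ) : ℝ)) ≤ ((p : ℝ) / C) ^ ℓ := by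
  obtain ⟨C, hC, hmain⟩ := pratt2024_cor210_sumMin
  refine ⟨C, hC, fun p ℓ hp ι _ X Y Z hS huni => ?_⟩
  obtain ⟨a, b, c, habc⟩ := huni
  have hmin := hmain p ℓ hp ι X Y Z hS
  have hsum : (∑ i, ((min ((X i).card * (Y i).card)
      (min ((X i).card * (Z i).card) ((Y i).card * (Z i).card)) : ℕ) : ℝ)) =
        ∑ _i : ι, ((min (a * b) (min (a * c) (b * c)) : ℕ) : ℝ) := by
    refine Finset.sum_congr rfl fun i _ => ?_
    rw [(habc i).1, (habc i).2.1, (habc i).2.2]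
  have hXY : ∑ i, (((X i).card * (Y i).card : ℕ) : ℝ) = ∑ _i : ι, ((a * b : ℕ) : ℝ) :=
    Finset.sum_congr rfl fun i _ => by rw [(habc i).1, (habc i).2.1]
  have hXZ : ∑ i, (((X i).card * (Z i).card : ℕ) : ℝ) = ∑ _i : ι, ((a * c : ℕ) : ℝ) :=
    Finset.sum_congr rfl fun i _ => by rw [(habc i).1, (habc i).2.2]
  have hYZ : ∑ i, (((Y i).card * (Z i).card : ℕ) : ℝ) = ∑ _i : ι, ((b * c : ℕ) : ℝ) :=
    Finset.sum_congr rfl fun i _ => by rw [(habc i).2.1, (habc i).2.2]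
  rw [hsum] at hmin
  rcases le_total (a * b) (min (a * c) (b * c)) with h1 | h1
  · left
    rw [hXY]
    simpa only [min_eq_left h1] using hmin
  · rw [min_eq_right h1] at hmin
    rcases le_total (a * c) (b * c) with h2 | h2
    · right; left
      rw [hXZ]
      simpa only [min_eq_left h2] using hmin
    · right; right
      rw [hYZ]
      simpa only [min_eq_right h2] using hmin

end Literature.Computability.AlgebraicComplexity

end
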